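import Mathlib
import HarnessLib
import Summits.HubbardSuperconductivity.HubbardSuperconductivity.Theorems.DeformationLadderLowEnergyRigidityCondensateHeavy
import Literature.MathematicalPhysics.QuantumLattice.PairChirality

/-!
# Route `DeformationLadder` — crux `LowEnergyRigidity` (stmt-HubbardSuperconductivity-1892),
# crux idea `heavy-condensate-fibration`, item 4: the pair condensate is current-neutral

The card's exact identity behind its "second-order London bound with the exact `O(U²)` paramagnetic
identity": the total (paramagnetic) current in the `e₁`-direction,
`𝒥 = Σ_{x,σ} (c†_{x+e₁,σ} c_{x,σ} - c†_{x,σ} c_{x+e₁,σ})` (anti-Hermitian normalisation, `J = i𝒥`),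
COMMUTES EXACTLY with every translation-invariant zero-momentum pair field `Δ_g = Σ_y P_y`
(`hcf_current_commute_pairField`, for EVERY form factor `g`), hence with `Δ_gᴴ`, with the pair density
`Δ_gᴴ Δ_g` and with the condensate operator `Π_L = L⁻⁴ Δᴴ Δ` (`hcf_current_commute_condOp`).
Reason: `[c†_{x+e₁,σ}c_{x,σ}, c_{y,τ}c_{y+e,τ'}]` is a difference of two Kronecker terms
(`hop_pairAnnihilation_commutator`); summed over the translation group of the torus the four surviving
pair operators cancel in pairs after the shifts `y ↦ y ± e₁` and one anticommutation. In momentum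
space this is `[Σ_k 2 sin k₁ (n_{k↑} + n_{k↓}), c_{-k↓} c_{k↑}] = 0`: removing the pair `(k↑, -k↓)`
changes the current by `2 sin k₁ + 2 sin(-k₁) = 0`. Since the hopping is also diagonal in momentum,
only the interaction `U Σ n↑n↓` fails to conserve `𝒥` — the screening of the stiffness is `O(U²)`
(card item 4; the spectral identity for `Λ_para` is not formalised here).
-/

namespace Summit.HubbardSuperconductivity.HubbardSuperconductivity.Theorems

set_option linter.dupNamespace false

open Literature.MathematicalPhysics.QuantumLattice Literature.Probability.LatticeModels Matrix Finset
open scoped ComplexOrder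

section Current

variable (L : ℕ) [NeZero L]

/-- Orbitals of torus sites are equal iff sites and spins are. [folklore] -/
theorem hcf_orb_ofTorusSite_inj {u v : TorusSite 2 L} {σ τ : Fin 2} :
    orb (FermionTorus.ofTorusSite u) σ = orb (FermionTorus.ofTorusSite v) τ ↔ u = v ∧ σ = τ := by
  rw [orb_inj]
  constructor
  · rintro ⟨h, rfl⟩
    exact ⟨FermionTorus.equivTorusSite.symm.injective h, rfl⟩
  · rintro ⟨rfl, rfl⟩
    exact ⟨rfl, rfl⟩

/-- Evaluation of a double Kronecker sum over sites and spins. [folklore] -/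
theorem hcf_sum_sum_ite_orb_eq {M : Type*} [AddCommMonoid M] (w v : TorusSite 2 L) (τ : Fin 2)
    (f : TorusSite 2 L → Fin 2 → M) :
    (∑ x : TorusSite 2 L, ∑ σ : Fin 2,
        if orb (FermionTorus.ofTorusSite (x + w)) σ = orb (FermionTorus.ofTorusSite v) τ
          then f x σ else 0) = f (v - w) τ := by
  have h : ∀ x : TorusSite 2 L, ∀ σ : Fin 2,
      (if orb (FermionTorus.ofTorusSite (x + w)) σ = orb (FermionTorus.ofTorusSite v) τ then f x σ else 0) =
        if x = v - w ∧ σ = τ then f x σ else 0 := by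
    intro x σ
    by_cases h1 : orb (FermionTorus.ofTorusSite (x + w)) σ = orb (FermionTorus.ofTorusSite v) τ
    · have h2 : x = v - w ∧ σ = τ := by
        obtain ⟨h, h'⟩ := (hcf_orb_ofTorusSite_inj L).1 h1
        exact ⟨eq_sub_of_add_eq h, h'⟩
      rw [if_pos h1, if_pos h2]
    · have h2 : ¬ (x = v - w ∧ σ = τ) := fun ⟨hx, hσ⟩ =>
        h1 ((hcf_orb_ofTorusSite_inj L).2 ⟨by rw [hx, sub_add_cancel], hσ⟩)
      rw [if_neg h1, if_neg h2]
  simp_rw [h]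
  rw [Finset.sum_eq_single (v - w)]
  · rw [Finset.sum_eq_single τ]
    · simp
    · intro σ _ hσ; rw [if_neg (fun h => hσ h.2)]
    · intro h; exact absurd (mem_univ τ) h
  · intro x _ hx
    exact Finset.sum_eq_zero fun σ _ => if_neg (fun h => hx h.1)
  · intro h; exact absurd (mem_univ _) h

/-- **The commutator of the total current with a translated pair product vanishes after the
translation sum**: for every step `e`, spins `τ, τ'` and `e₁ = (1,0)`,
`Σ_y [𝒥, c_{y,τ} c_{y+e,τ'}] = 0`. [folklore] -/
theorem hcf_sum_commutator_current_pairProduct (e : TorusSite 2 L) (τ τ' : Fin 2) :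
    ∑ y : TorusSite 2 L,
      ((∑ x : TorusSite 2 L, ∑ σ : Fin 2,
          (creation (orb (FermionTorus.ofTorusSite (x + Pi.single 0 1)) σ) *
              annihilation (orb (FermionTorus.ofTorusSite x) σ) -
            creation (orb (FermionTorus.ofTorusSite x) σ) *
              annihilation (orb (FermionTorus.ofTorusSite (x + Pi.single 0 1)) σ))) *
          (annihilation (orb (FermionTorus.ofTorusSite y) τ) *
            annihilation (orb (FermionTorus.ofTorusSite (y + e)) τ')) -
        (annihilation (orb (FermionTorus.ofTorusSite y) τ) *
            annihilation (orb (FermionTorus.ofTorusSite (y + e)) τ')) *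
          (∑ x : TorusSite 2 L, ∑ σ : Fin 2,
            (creation (orb (FermionTorus.ofTorusSite (x + Pi.single 0 1)) σ) *
                annihilation (orb (FermionTorus.ofTorusSite x) σ) -
              creation (orb (FermionTorus.ofTorusSite x) σ) *
                annihilation (orb (FermionTorus.ofTorusSite (x + Pi.single 0 1)) σ)))) = 0 := by
  -- abbreviation for the step `e₁ = (1,0)`
  set e₁ : TorusSite 2 L := Pi.single 0 1 with he₁
  -- the `gl`-commutator of a hopping with a pair product, with this file's decidability instances
  have hop' : ∀ a b p q : Orb (FermionTorus 2 L),
      creation a * annihilation b * (annihilation p * annihilation q) -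
          annihilation p * annihilation q * (creation a * annihilation b) =
        (if a = p then annihilation q * annihilation b else 0) -
          (if a = q then annihilation p * annihilation b else 0) := fun a b p q => by
    convert PairChirality.hop_pairAnnihilation_commutator a b p q
  -- the commutator of ONE hopping term with the pair product (Kronecker form)
  have hA : ∀ (x y : TorusSite 2 L) (σ : Fin 2),
      creation (orb (FermionTorus.ofTorusSite (x + e₁)) σ) * annihilation (orb (FermionTorus.ofTorusSite (x)) σ) * (annihilation (orb (FermionTorus.ofTorusSite (y)) τ) * annihilation (orb (FermionTorus.ofTorusSite (y + e)) τ')) -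
          annihilation (orb (FermionTorus.ofTorusSite (y)) τ) * annihilation (orb (FermionTorus.ofTorusSite (y + e)) τ') * (creation (orb (FermionTorus.ofTorusSite (x + e₁)) σ) * annihilation (orb (FermionTorus.ofTorusSite (x)) σ)) =
        (if orb (FermionTorus.ofTorusSite (x + e₁)) σ = orb (FermionTorus.ofTorusSite y) τ
            then annihilation (orb (FermionTorus.ofTorusSite (y + e)) τ') * annihilation (orb (FermionTorus.ofTorusSite (x)) σ) else 0) -
          (if orb (FermionTorus.ofTorusSite (x + e₁)) σ = orb (FermionTorus.ofTorusSite (y + e)) τ'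
            then annihilation (orb (FermionTorus.ofTorusSite (y)) τ) * annihilation (orb (FermionTorus.ofTorusSite (x)) σ) else 0) := fun x y σ =>
    hop' _ _ _ _
  have hB : ∀ (x y : TorusSite 2 L) (σ : Fin 2),
      creation (orb (FermionTorus.ofTorusSite (x)) σ) * annihilation (orb (FermionTorus.ofTorusSite (x + e₁)) σ) * (annihilation (orb (FermionTorus.ofTorusSite (y)) τ) * annihilation (orb (FermionTorus.ofTorusSite (y + e)) τ')) -
          annihilation (orb (FermionTorus.ofTorusSite (y)) τ) * annihilation (orb (FermionTorus.ofTorusSite (y + e)) τ') * (creation (orb (FermionTorus.ofTorusSite (x)) σ) * annihilation (orb (FermionTorus.ofTorusSite (x + e₁)) σ)) =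
        (if orb (FermionTorus.ofTorusSite (x + 0)) σ = orb (FermionTorus.ofTorusSite y) τ
            then annihilation (orb (FermionTorus.ofTorusSite (y + e)) τ') * annihilation (orb (FermionTorus.ofTorusSite (x + e₁)) σ) else 0) -
          (if orb (FermionTorus.ofTorusSite (x + 0)) σ = orb (FermionTorus.ofTorusSite (y + e)) τ'
            then annihilation (orb (FermionTorus.ofTorusSite (y)) τ) * annihilation (orb (FermionTorus.ofTorusSite (x + e₁)) σ) else 0) := fun x y σ => by
    rw [add_zero]; exact hop' _ _ _ _
  -- the commutator of the whole current with the pair product at `y`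
  have hJ : ∀ y : TorusSite 2 L,
      (∑ x : TorusSite 2 L, ∑ σ : Fin 2, (creation (orb (FermionTorus.ofTorusSite (x + e₁)) σ) * annihilation (orb (FermionTorus.ofTorusSite (x)) σ) - creation (orb (FermionTorus.ofTorusSite (x)) σ) * annihilation (orb (FermionTorus.ofTorusSite (x + e₁)) σ))) *
          (annihilation (orb (FermionTorus.ofTorusSite (y)) τ) * annihilation (orb (FermionTorus.ofTorusSite (y + e)) τ')) -
        annihilation (orb (FermionTorus.ofTorusSite (y)) τ) * annihilation (orb (FermionTorus.ofTorusSite (y + e)) τ') *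
          (∑ x : TorusSite 2 L, ∑ σ : Fin 2, (creation (orb (FermionTorus.ofTorusSite (x + e₁)) σ) * annihilation (orb (FermionTorus.ofTorusSite (x)) σ) - creation (orb (FermionTorus.ofTorusSite (x)) σ) * annihilation (orb (FermionTorus.ofTorusSite (x + e₁)) σ))) =
        annihilation (orb (FermionTorus.ofTorusSite (y + e)) τ') * annihilation (orb (FermionTorus.ofTorusSite (y - e₁)) τ) - annihilation (orb (FermionTorus.ofTorusSite (y)) τ) * annihilation (orb (FermionTorus.ofTorusSite (y + e - e₁)) τ') -
          (annihilation (orb (FermionTorus.ofTorusSite (y + e)) τ') * annihilation (orb (FermionTorus.ofTorusSite (y + e₁)) τ) - annihilation (orb (FermionTorus.ofTorusSite (y)) τ) * annihilation (orb (FermionTorus.ofTorusSite (y + e + e₁)) τ')) := by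
    intro y
    rw [Finset.sum_mul, Finset.mul_sum, ← Finset.sum_sub_distrib]
    have hin : ∀ x : TorusSite 2 L,
        (∑ σ : Fin 2, (creation (orb (FermionTorus.ofTorusSite (x + e₁)) σ) * annihilation (orb (FermionTorus.ofTorusSite (x)) σ) - creation (orb (FermionTorus.ofTorusSite (x)) σ) * annihilation (orb (FermionTorus.ofTorusSite (x + e₁)) σ))) *
            (annihilation (orb (FermionTorus.ofTorusSite (y)) τ) * annihilation (orb (FermionTorus.ofTorusSite (y + e)) τ')) -
          annihilation (orb (FermionTorus.ofTorusSite (y)) τ) * annihilation (orb (FermionTorus.ofTorusSite (y + e)) τ') *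
            ∑ σ : Fin 2, (creation (orb (FermionTorus.ofTorusSite (x + e₁)) σ) * annihilation (orb (FermionTorus.ofTorusSite (x)) σ) - creation (orb (FermionTorus.ofTorusSite (x)) σ) * annihilation (orb (FermionTorus.ofTorusSite (x + e₁)) σ)) =
        ∑ σ : Fin 2, ((creation (orb (FermionTorus.ofTorusSite (x + e₁)) σ) * annihilation (orb (FermionTorus.ofTorusSite (x)) σ) * (annihilation (orb (FermionTorus.ofTorusSite (y)) τ) * annihilation (orb (FermionTorus.ofTorusSite (y + e)) τ')) -
            annihilation (orb (FermionTorus.ofTorusSite (y)) τ) * annihilation (orb (FermionTorus.ofTorusSite (y + e)) τ') * (creation (orb (FermionTorus.ofTorusSite (x + e₁)) σ) * annihilation (orb (FermionTorus.ofTorusSite (x)) σ))) -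
          (creation (orb (FermionTorus.ofTorusSite (x)) σ) * annihilation (orb (FermionTorus.ofTorusSite (x + e₁)) σ) * (annihilation (orb (FermionTorus.ofTorusSite (y)) τ) * annihilation (orb (FermionTorus.ofTorusSite (y + e)) τ')) -
            annihilation (orb (FermionTorus.ofTorusSite (y)) τ) * annihilation (orb (FermionTorus.ofTorusSite (y + e)) τ') * (creation (orb (FermionTorus.ofTorusSite (x)) σ) * annihilation (orb (FermionTorus.ofTorusSite (x + e₁)) σ)))) := by
      intro x
      rw [Finset.sum_mul, Finset.mul_sum, ← Finset.sum_sub_distrib]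
      refine Finset.sum_congr rfl fun σ _ => ?_
      noncomm_ring
    simp_rw [hin, hA, hB, Finset.sum_sub_distrib]
    rw [hcf_sum_sum_ite_orb_eq, hcf_sum_sum_ite_orb_eq, hcf_sum_sum_ite_orb_eq, hcf_sum_sum_ite_orb_eq,
      sub_zero, sub_zero]
  simp only [hJ]
  -- the translation sum: shift `y ↦ y + e₁` in the first term, `y ↦ y - e₁` in the third
  rw [Finset.sum_sub_distrib, Finset.sum_sub_distrib, Finset.sum_sub_distrib]
  have h1 : ∑ y : TorusSite 2 L, annihilation (orb (FermionTorus.ofTorusSite (y + e)) τ') * annihilation (orb (FermionTorus.ofTorusSite (y - e₁)) τ) =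
      ∑ y : TorusSite 2 L, annihilation (orb (FermionTorus.ofTorusSite (y + e + e₁)) τ') * annihilation (orb (FermionTorus.ofTorusSite (y)) τ) := by
    refine Fintype.sum_equiv (Equiv.subRight e₁) _ _ fun y => ?_
    simp only [Equiv.subRight_apply]
    congr 4
    abel
  have h3 : ∑ y : TorusSite 2 L, annihilation (orb (FermionTorus.ofTorusSite (y + e)) τ') * annihilation (orb (FermionTorus.ofTorusSite (y + e₁)) τ) =
      ∑ y : TorusSite 2 L, annihilation (orb (FermionTorus.ofTorusSite (y + e - e₁)) τ') * annihilation (orb (FermionTorus.ofTorusSite (y)) τ) := by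
    refine Fintype.sum_equiv (Equiv.addRight e₁) _ _ fun y => ?_
    simp only [Equiv.coe_addRight]
    congr 4
    abel
  -- anticommutation `c_p c_q = -c_q c_p`
  have hanti : ∀ (p q : Orb (FermionTorus 2 L)), annihilation p * annihilation q = -(annihilation q * annihilation p) :=
    fun p q => eq_neg_of_add_eq_zero_left (annihilation_anticommute_holds p q)
  rw [h1, h3]
  have h4 : ∑ y : TorusSite 2 L, annihilation (orb (FermionTorus.ofTorusSite (y + e + e₁)) τ') * annihilation (orb (FermionTorus.ofTorusSite (y)) τ) =
      -∑ y : TorusSite 2 L, annihilation (orb (FermionTorus.ofTorusSite (y)) τ) * annihilation (orb (FermionTorus.ofTorusSite (y + e + e₁)) τ') := by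
    rw [← Finset.sum_neg_distrib]
    exact Finset.sum_congr rfl fun y _ => hanti _ _
  have h5 : ∑ y : TorusSite 2 L, annihilation (orb (FermionTorus.ofTorusSite (y + e - e₁)) τ') * annihilation (orb (FermionTorus.ofTorusSite (y)) τ) =
      -∑ y : TorusSite 2 L, annihilation (orb (FermionTorus.ofTorusSite (y)) τ) * annihilation (orb (FermionTorus.ofTorusSite (y + e - e₁)) τ') := by
    rw [← Finset.sum_neg_distrib]
    exact Finset.sum_congr rfl fun y _ => hanti _ _
  rw [h4, h5]
  abel

/-- **The pair condensate is current-neutral** (card `heavy-condensate-fibration`, item 4): the total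
current `𝒥 = Σ_{x,σ} (c†_{x+e₁,σ}c_{x,σ} - c†_{x,σ}c_{x+e₁,σ})` commutes with the pair field
`Δ_g = Σ_y P_y` for EVERY form factor `g`. [folklore] -/
theorem hcf_current_commute_pairField (g : Site 2 → ℝ) :
    Commute (∑ x : TorusSite 2 L, ∑ σ : Fin 2,
        (creation (orb (FermionTorus.ofTorusSite (x + Pi.single 0 1)) σ) *
            annihilation (orb (FermionTorus.ofTorusSite x) σ) -
          creation (orb (FermionTorus.ofTorusSite x) σ) *
            annihilation (orb (FermionTorus.ofTorusSite (x + Pi.single 0 1)) σ)))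
      (pairField g L) := by
  set J := ∑ x : TorusSite 2 L, ∑ σ : Fin 2,
        (creation (orb (FermionTorus.ofTorusSite (x + Pi.single 0 1)) σ) *
            annihilation (orb (FermionTorus.ofTorusSite x) σ) -
          creation (orb (FermionTorus.ofTorusSite x) σ) *
            annihilation (orb (FermionTorus.ofTorusSite (x + Pi.single 0 1)) σ)) with hJ
  rw [Commute, SemiconjBy, ← sub_eq_zero]
  -- `Δ_g = Σ_e (g e/√2) • Σ_y (c_{y↑}c_{y+e,↓} - c_{y↓}c_{y+e,↑})`
  have hΔ : pairField g L = ∑ e ∈ insert (0 : Site 2) unitSteps, ((g e / Real.sqrt 2 : ℝ) : ℂ) •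
      ∑ y : TorusSite 2 L,
        (annihilation (orb (FermionTorus.ofTorusSite y) 0) *
            annihilation (orb (FermionTorus.ofTorusSite (y + Torus.proj L e)) 1) -
          annihilation (orb (FermionTorus.ofTorusSite y) 1) *
            annihilation (orb (FermionTorus.ofTorusSite (y + Torus.proj L e)) 0)) := by
    rw [pairField]
    simp only [localPair, Finset.smul_sum]
    rw [Finset.sum_comm]
  rw [hΔ, Finset.mul_sum, Finset.sum_mul, ← Finset.sum_sub_distrib]
  refine Finset.sum_eq_zero fun e _ => ?_
  rw [mul_smul_comm, smul_mul_assoc, ← smul_sub, Finset.mul_sum, Finset.sum_mul, ← Finset.sum_sub_distrib]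
  have hsplit : ∀ y : TorusSite 2 L,
      J * (annihilation (orb (FermionTorus.ofTorusSite y) 0) *
            annihilation (orb (FermionTorus.ofTorusSite (y + Torus.proj L e)) 1) -
          annihilation (orb (FermionTorus.ofTorusSite y) 1) *
            annihilation (orb (FermionTorus.ofTorusSite (y + Torus.proj L e)) 0)) -
        (annihilation (orb (FermionTorus.ofTorusSite y) 0) *
            annihilation (orb (FermionTorus.ofTorusSite (y + Torus.proj L e)) 1) -
          annihilation (orb (FermionTorus.ofTorusSite y) 1) *
            annihilation (orb (FermionTorus.ofTorusSite (y + Torus.proj L e)) 0)) * J =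
        (J * (annihilation (orb (FermionTorus.ofTorusSite y) 0) *
            annihilation (orb (FermionTorus.ofTorusSite (y + Torus.proj L e)) 1)) -
          (annihilation (orb (FermionTorus.ofTorusSite y) 0) *
            annihilation (orb (FermionTorus.ofTorusSite (y + Torus.proj L e)) 1)) * J) -
        (J * (annihilation (orb (FermionTorus.ofTorusSite y) 1) *
            annihilation (orb (FermionTorus.ofTorusSite (y + Torus.proj L e)) 0)) -
          (annihilation (orb (FermionTorus.ofTorusSite y) 1) *
            annihilation (orb (FermionTorus.ofTorusSite (y + Torus.proj L e)) 0)) * J) := by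
    intro y
    noncomm_ring
  simp_rw [hsplit]
  rw [Finset.sum_sub_distrib, hJ, hcf_sum_commutator_current_pairProduct, hcf_sum_commutator_current_pairProduct,
    sub_zero, smul_zero]

/-- The current commutes with `Δ_gᴴ` as well (`𝒥ᴴ = -𝒥`). [folklore] -/
theorem hcf_current_commute_pairField_conjTranspose (g : Site 2 → ℝ) :
    Commute (∑ x : TorusSite 2 L, ∑ σ : Fin 2,
        (creation (orb (FermionTorus.ofTorusSite (x + Pi.single 0 1)) σ) *
            annihilation (orb (FermionTorus.ofTorusSite x) σ) -
          creation (orb (FermionTorus.ofTorusSite x) σ) *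
            annihilation (orb (FermionTorus.ofTorusSite (x + Pi.single 0 1)) σ)))
      (pairField g L)ᴴ := by
  set J := ∑ x : TorusSite 2 L, ∑ σ : Fin 2,
        (creation (orb (FermionTorus.ofTorusSite (x + Pi.single 0 1)) σ) *
            annihilation (orb (FermionTorus.ofTorusSite x) σ) -
          creation (orb (FermionTorus.ofTorusSite x) σ) *
            annihilation (orb (FermionTorus.ofTorusSite (x + Pi.single 0 1)) σ)) with hJ
  have hJadj : Jᴴ = -J := by
    rw [hJ, conjTranspose_sum]
    rw [← Finset.sum_neg_distrib]
    refine Finset.sum_congr rfl fun x _ => ?_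
    rw [conjTranspose_sum, ← Finset.sum_neg_distrib]
    refine Finset.sum_congr rfl fun σ _ => ?_
    rw [conjTranspose_sub, conjTranspose_mul, conjTranspose_mul, annihilation_conjTranspose,
      creation_conjTranspose, annihilation_conjTranspose, creation_conjTranspose]
    abel
  have h := hcf_current_commute_pairField L g
  rw [← hJ] at h
  -- take adjoints: `(J Δ)ᴴ = Δᴴ Jᴴ = -Δᴴ J`, `(Δ J)ᴴ = Jᴴ Δᴴ = -J Δᴴ`
  have h2 := congrArg conjTranspose h.eq
  rw [conjTranspose_mul, conjTranspose_mul, hJadj, mul_neg, neg_mul, neg_inj] at h2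
  exact h2.symm

/-- **The condensate operator conserves the current**: `𝒥` commutes with the pair density `Δ_gᴴ Δ_g`
and with `Π = c • Δ_gᴴ Δ_g` for every scalar `c` (in particular `Π_L = L⁻⁴ Δᴴ Δ`), so `𝒥` is a good
quantum number inside the `Π`-fibration (card item 4). [folklore] -/
theorem hcf_current_commute_condOp (g : Site 2 → ℝ) (c : ℂ) :
    Commute (∑ x : TorusSite 2 L, ∑ σ : Fin 2,
        (creation (orb (FermionTorus.ofTorusSite (x + Pi.single 0 1)) σ) *
            annihilation (orb (FermionTorus.ofTorusSite x) σ) -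
          creation (orb (FermionTorus.ofTorusSite x) σ) *
            annihilation (orb (FermionTorus.ofTorusSite (x + Pi.single 0 1)) σ)))
      (c • ((pairField g L)ᴴ * pairField g L)) :=
  ((hcf_current_commute_pairField_conjTranspose L g).mul_right (hcf_current_commute_pairField L g)).smul_right c

end Current

end Summit.HubbardSuperconductivity.HubbardSuperconductivity.Theorems
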